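import Mathlib
import Literature.Combinatorics.SimpleGraph.PaleySosLevelTwo
import Literature.Combinatorics.SimpleGraph.PaleyT441M0
import Literature.Combinatorics.SimpleGraph.PaleyT441M1
import HarnessLib

/-!
# Kunisky–Yu 2022, Theorem 3.35 (`‖T^{4,4,1}‖ = O(p^{5/4})`) from FKM, and Theorem 1.2 from FKM — PROVED

Topic `Literature/Combinatorics/SimpleGraph`; closes the chain behind the named fact
`Literature.Combinatorics.SimpleGraph.kuniskyYu2022_theorem_1_2` (degree-4 SOS cannot certify
`ω(G_p) ≤ p^{1/3}` for the Paley graphs) down to ONE deep input, the Fouvry–Kowalski–Michel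
estimate for sums of products of four Kloosterman sums [FKM15, Corollary 3.2] (Deligne's Weil II
and Katz's computation of the monodromy of Kloosterman sheaves), taken here as an explicit
hypothesis `hFKM`:

* `abs_paleyT441_form_le` — for `p` an odd prime, `C ≥ 0` and `hFKM` at `p`: the 4-cycle
  graph-matrix form `Θ_p(V) = ∑_{a,b,c,d} V_{ab} V_{cd} χ(a−c)χ(a−d)χ(b−c)χ(b−d)` satisfies
  `|Θ_p(V)| ≤ (2p + (2R₀/p)^{1/2}) ∑ V_{ab}²` for every zero-diagonal `V` (`R₀ = 64p³+p+(C+8)p³√p`);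
  this is Kunisky–Yu's Theorem 3.35 in quadratic-form language (translation Fourier reduction
  `PaleyT441Fourier`, zero frequency `PaleyT441M0` — where [Liu02] turned out to be elementary —
  and frequency one `PaleyT441M1`);
* `paleyT441_hypothesis_of_kloosterman4` — the hypothesis of the landed bridge
  `kuniskyYu2022_theorem_1_2_of_T441` with `C' = 2 + (2(C+73))^{1/2}`;
* `kuniskyYu2022_theorem_1_2_of_kloosterman4` — **Theorem 1.2 from FKM Cor. 3.2** (`r = 2`,
  `k = 4`, `h = 0`, unnormalised: `∃ C, ∀ p, ∀ a,b,c,d ∈ 𝔽_pˣ` not paired,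
  `|∑_{x≠0} K(ax)K(bx)K(cx)K(dx)| ≤ C p^{5/2}`).

## References

* D. Kunisky, X. Yu, arXiv:2211.02713 (2022), Theorems 1.2, 3.35, 4.20, 4.22, §4.7.  [KuniskyYu2022]
* É. Fouvry, E. Kowalski, Ph. Michel, *A study in sums of products*, Phil. Trans. R. Soc. A 373
  (2015) 20140309, Corollary 3.2 (arXiv:1405.2293, Cor. 3.3).
-/

noncomputable section

open Finset Matrix
open Literature.NumberTheory.LFunctions

namespace Literature.Combinatorics.SimpleGraph

section Bound

variable {p : ℕ} [hp : Fact p.Prime]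

/-- Re-indexing the 4-cycle form by differences: with `b = a + s`, `d = c + t`,
`Θ_p(V) = ∑_{s,t,a,c} V_{a,a+s} V_{c,c+t} g_{s,t}(a − c)` (as a complex number), where
`g_{s,t}(u) = χ(u)χ(u−t)χ(u+s)χ(u+s−t)`. [cite: KuniskyYu2022, §4.7.1 (110)–(113)] -/
theorem paleyT441_form_eq_kernel_form (V : Matrix (ZMod p) (ZMod p) ℝ) :
    (((∑ a : ZMod p, ∑ b : ZMod p, ∑ c : ZMod p, ∑ d : ZMod p, V a b * V c d *
        (((quadraticChar (ZMod p) (a - c) : ℤ) : ℝ) * ((quadraticChar (ZMod p) (a - d) : ℤ) : ℝ) *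
          ((quadraticChar (ZMod p) (b - c) : ℤ) : ℝ) * ((quadraticChar (ZMod p) (b - d) : ℤ) : ℝ))
        : ℝ) : ℂ)) =
      ∑ s : ZMod p, ∑ t : ZMod p, ∑ a : ZMod p, ∑ c : ZMod p,
        ((V a (a + s) : ℝ) : ℂ) * (starRingEnd ℂ) ((V c (c + t) : ℝ) : ℂ) *
          (((quadraticChar (ZMod p) (a - c) : ℤ) : ℂ) *
            ((quadraticChar (ZMod p) (a - c - t) : ℤ) : ℂ) *
            ((quadraticChar (ZMod p) (a - c + s) : ℤ) : ℂ) *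
            ((quadraticChar (ZMod p) (a - c + s - t) : ℤ) : ℂ)) := by
  push_cast
  -- both sides equal `∑ a, ∑ s, ∑ c, ∑ t, H a s c t`
  set H : ZMod p → ZMod p → ZMod p → ZMod p → ℂ := fun a s c t =>
    (V a (a + s) : ℂ) * (V c (c + t) : ℂ) *
      (((quadraticChar (ZMod p) (a - c) : ℤ) : ℂ) *
        ((quadraticChar (ZMod p) (a - c - t) : ℤ) : ℂ) *
        ((quadraticChar (ZMod p) (a - c + s) : ℤ) : ℂ) *
        ((quadraticChar (ZMod p) (a - c + s - t) : ℤ) : ℂ)) with hH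
  -- left side
  have hA : ∀ a : ZMod p, ∑ b : ZMod p, ∑ c : ZMod p, ∑ d : ZMod p, (V a b : ℂ) * (V c d : ℂ) *
      (((quadraticChar (ZMod p) (a - c) : ℤ) : ℂ) * ((quadraticChar (ZMod p) (a - d) : ℤ) : ℂ) *
        ((quadraticChar (ZMod p) (b - c) : ℤ) : ℂ) * ((quadraticChar (ZMod p) (b - d) : ℤ) : ℂ)) =
      ∑ s : ZMod p, ∑ c : ZMod p, ∑ t : ZMod p, H a s c t := by
    intro a
    refine (Fintype.sum_equiv (Equiv.addLeft a) _ _ fun s => ?_).symm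
    show ∑ c : ZMod p, ∑ t : ZMod p, H a s c t = _
    refine Finset.sum_congr rfl fun c _ => ?_
    refine Fintype.sum_equiv (Equiv.addLeft c) _ _ fun t => ?_
    show H a s c t = _
    rw [hH]
    simp only [Equiv.coe_addLeft]
    have e1 : a - (c + t) = a - c - t := by ring
    have e2 : a + s - c = a - c + s := by ring
    have e3 : a + s - (c + t) = a - c + s - t := by ring
    rw [e1, e2, e3]
  simp_rw [hA]
  -- right side: reorder `∑ s, ∑ t, ∑ a, ∑ c` to `∑ a, ∑ s, ∑ c, ∑ t`
  symm
  calc ∑ s : ZMod p, ∑ t : ZMod p, ∑ a : ZMod p, ∑ c : ZMod p,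
        ((V a (a + s) : ℝ) : ℂ) * (starRingEnd ℂ) ((V c (c + t) : ℝ) : ℂ) *
          (((quadraticChar (ZMod p) (a - c) : ℤ) : ℂ) *
            ((quadraticChar (ZMod p) (a - c - t) : ℤ) : ℂ) *
            ((quadraticChar (ZMod p) (a - c + s) : ℤ) : ℂ) *
            ((quadraticChar (ZMod p) (a - c + s - t) : ℤ) : ℂ))
      = ∑ s : ZMod p, ∑ t : ZMod p, ∑ a : ZMod p, ∑ c : ZMod p, H a s c t := by
        refine Finset.sum_congr rfl fun s _ => Finset.sum_congr rfl fun t _ =>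
          Finset.sum_congr rfl fun a _ => Finset.sum_congr rfl fun c _ => ?_
        rw [Complex.conj_ofReal, hH]
    _ = ∑ s : ZMod p, ∑ a : ZMod p, ∑ t : ZMod p, ∑ c : ZMod p, H a s c t :=
        Finset.sum_congr rfl fun s _ => Finset.sum_comm
    _ = ∑ a : ZMod p, ∑ s : ZMod p, ∑ t : ZMod p, ∑ c : ZMod p, H a s c t := Finset.sum_comm
    _ = ∑ a : ZMod p, ∑ s : ZMod p, ∑ c : ZMod p, ∑ t : ZMod p, H a s c t :=
        Finset.sum_congr rfl fun a _ => Finset.sum_congr rfl fun s _ => Finset.sum_comm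

/-- **Kunisky–Yu 2022, Theorem 3.35, from FKM** (quadratic-form version): for an odd prime `p`,
`C ≥ 0` and the four-Kloosterman estimate `hFKM` at `p`, every zero-diagonal real matrix `V` on
`𝔽_p` satisfies `|Θ_p(V)| ≤ (2p + √(2R₀)/√p) ∑_{a,b} V_{ab}²`, `R₀ = 64p³ + p + (C+8)p³√p`.
[cite: KuniskyYu2022, Theorem 3.35] -/
theorem abs_paleyT441_form_le (hp2 : p ≠ 2) {C : ℝ} (hC : 0 ≤ C)
    (hFKM : ∀ a b c d : ZMod p, a ≠ 0 → b ≠ 0 → c ≠ 0 → d ≠ 0 →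
      ¬ ((a = b ∧ c = d) ∨ (a = c ∧ b = d) ∨ (a = d ∧ b = c)) →
      ‖∑ x ∈ (Finset.univ : Finset (ZMod p)).erase 0,
          kloostermanSum p 1 (a * x) * kloostermanSum p 1 (b * x) *
            kloostermanSum p 1 (c * x) * kloostermanSum p 1 (d * x)‖ ≤
        C * ((p : ℝ) ^ 2 * Real.sqrt p))
    (V : Matrix (ZMod p) (ZMod p) ℝ) (hV0 : ∀ a, V a a = 0) :
    |∑ a : ZMod p, ∑ b : ZMod p, ∑ c : ZMod p, ∑ d : ZMod p, V a b * V c d *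
        (((quadraticChar (ZMod p) (a - c) : ℤ) : ℝ) * ((quadraticChar (ZMod p) (a - d) : ℤ) : ℝ) *
          ((quadraticChar (ZMod p) (b - c) : ℤ) : ℝ) * ((quadraticChar (ZMod p) (b - d) : ℤ) : ℝ))| ≤
      (2 * p + Real.sqrt (2 * (64 * (p : ℝ) ^ 3 + p + (C + 8) * ((p : ℝ) ^ 3 * Real.sqrt p))) /
        Real.sqrt p) * ∑ a : ZMod p, ∑ b : ZMod p, V a b ^ 2 := by
  set B₁ : ℝ := Real.sqrt (2 * (64 * (p : ℝ) ^ 3 + p + (C + 8) * ((p : ℝ) ^ 3 * Real.sqrt p))) /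
    Real.sqrt p with hB₁
  have hB₁0 : 0 ≤ B₁ := by positivity
  have hp0 : (0 : ℝ) ≤ p := Nat.cast_nonneg p
  set B : ℝ := 2 * p + B₁ with hB
  -- the kernel and its two frequency bounds
  set g : ZMod p → ZMod p → ZMod p → ℂ := fun s t u => ((quadraticChar (ZMod p) u : ℤ) : ℂ) *
    ((quadraticChar (ZMod p) (u - t) : ℤ) : ℂ) * ((quadraticChar (ZMod p) (u + s) : ℤ) : ℂ) *
    ((quadraticChar (ZMod p) (u + s - t) : ℤ) : ℂ) with hg
  have hdil : ∀ r : ZMod p, r ≠ 0 → ∀ s t u : ZMod p, g (r * s) (r * t) (r * u) = g s t u := by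
    intro r hr s t u
    exact paleyKernel_dilation hr s t u
  have h0 : ∀ y : ZMod p → ℂ, y 0 = 0 →
      ‖∑ s : ZMod p, ∑ t : ZMod p, y s * (starRingEnd ℂ) (y t) * ∑ u : ZMod p, g s t u‖ ≤
        B * ∑ s : ZMod p, ‖y s‖ ^ 2 := by
    intro y hy
    refine (norm_paleyKernel_zeroFreq_form_le hp2 y hy).trans ?_
    exact mul_le_mul_of_nonneg_right (by rw [hB]; linarith) (Finset.sum_nonneg fun s _ => by positivity)
  have h1 : ∀ y : ZMod p → ℂ, y 0 = 0 →
      ‖∑ s : ZMod p, ∑ t : ZMod p, y s * (starRingEnd ℂ) (y t) *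
        ∑ u : ZMod p, g s t u * ZMod.stdAddChar u‖ ≤ B * ∑ s : ZMod p, ‖y s‖ ^ 2 := by
    intro y hy
    refine (norm_paleyKernel_oneFreq_form_le hp2 hC hFKM y hy).trans ?_
    exact mul_le_mul_of_nonneg_right (by rw [hB]; linarith) (Finset.sum_nonneg fun s _ => by positivity)
  -- apply the translation Fourier reduction to `x_s(a) = V_{a,a+s}`
  set x : ZMod p → ZMod p → ℂ := fun s a => ((V a (a + s) : ℝ) : ℂ) with hx
  have hx0 : ∀ a, x 0 a = 0 := by intro a; rw [hx]; simp [hV0 a]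
  have hmain := norm_translationKernel_form_le_of_zero_one g hdil B h0 h1 x hx0
  -- identify both sides
  have hL := paleyT441_form_eq_kernel_form V
  have hxnorm : ∑ s : ZMod p, ∑ a : ZMod p, ‖x s a‖ ^ 2 = ∑ a : ZMod p, ∑ b : ZMod p, V a b ^ 2 := by
    rw [Finset.sum_comm]
    refine Finset.sum_congr rfl fun a _ => ?_
    rw [hx]
    simp only [Complex.norm_real, Real.norm_eq_abs, sq_abs]
    exact Equiv.sum_comp (Equiv.addLeft a) (fun b => V a b ^ 2)
  rw [hxnorm] at hmain
  have hnorm : ‖∑ s : ZMod p, ∑ t : ZMod p, ∑ a : ZMod p, ∑ c : ZMod p,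
      x s a * (starRingEnd ℂ) (x t c) * g s t (a - c)‖ =
      |∑ a : ZMod p, ∑ b : ZMod p, ∑ c : ZMod p, ∑ d : ZMod p, V a b * V c d *
        (((quadraticChar (ZMod p) (a - c) : ℤ) : ℝ) * ((quadraticChar (ZMod p) (a - d) : ℤ) : ℝ) *
          ((quadraticChar (ZMod p) (b - c) : ℤ) : ℝ) * ((quadraticChar (ZMod p) (b - d) : ℤ) : ℝ))| := by
    rw [← Real.norm_eq_abs, ← Complex.norm_real, hL]
  rw [hnorm] at hmain
  exact hmain

/-- Constants: `2p + √(2R₀)/√p ≤ (2 + √(2(C+73))) p^{5/4}` for `p ≥ 1`. [folklore] -/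
theorem paleyT441_constant_le {P C : ℝ} (hP : 1 ≤ P) (hC : 0 ≤ C) :
    2 * P + Real.sqrt (2 * (64 * P ^ 3 + P + (C + 8) * (P ^ 3 * Real.sqrt P))) / Real.sqrt P ≤
      (2 + Real.sqrt (2 * (C + 73))) * P ^ ((5 : ℝ) / 4) := by
  have hP0 : 0 ≤ P := by linarith
  set r : ℝ := P ^ ((1 : ℝ) / 12) with hr
  have hr1 : 1 ≤ r := Real.one_le_rpow hP (by norm_num)
  have hr0 : 0 < r := by linarith
  have hr12 : r ^ 12 = P := by rw [hr, rpow_twelfth_pow hP0]; norm_num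
  have hr6 : Real.sqrt P = r ^ 6 := by rw [hr, rpow_twelfth_pow hP0, Real.sqrt_eq_rpow]; norm_num
  have hr15 : P ^ ((5 : ℝ) / 4) = r ^ 15 := by rw [hr, rpow_twelfth_pow hP0]; norm_num
  rw [hr6, hr15, ← hr12]
  -- `2 r¹² ≤ 2 r¹⁵`
  have h1 : 2 * r ^ 12 ≤ 2 * r ^ 15 := by
    have : r ^ 12 ≤ r ^ 15 := pow_le_pow_right₀ hr1 (by norm_num)
    linarith
  -- `√(2R₀) / r⁶ ≤ √(2(C+73)) r¹⁵`, i.e. `2R₀ ≤ 2(C+73) r⁴²`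
  have hR : 2 * (64 * (r ^ 12) ^ 3 + r ^ 12 + (C + 8) * ((r ^ 12) ^ 3 * r ^ 6)) ≤
      (Real.sqrt (2 * (C + 73)) * r ^ 15 * r ^ 6) ^ 2 := by
    rw [mul_pow, mul_pow, Real.sq_sqrt (by positivity)]
    have ha : (r ^ 12) ^ 3 ≤ (r ^ 12) ^ 3 * r ^ 6 := le_mul_of_one_le_right (by positivity)
      (one_le_pow₀ hr1)
    have hb : r ^ 12 ≤ (r ^ 12) ^ 3 * r ^ 6 := by
      calc r ^ 12 ≤ r ^ 42 := pow_le_pow_right₀ hr1 (by norm_num)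
        _ = (r ^ 12) ^ 3 * r ^ 6 := by ring
    have hc : 2 * (C + 73) * (r ^ 15) ^ 2 * (r ^ 6) ^ 2 = 2 * (C + 73) * ((r ^ 12) ^ 3 * r ^ 6) := by
      ring
    rw [hc]
    nlinarith [ha, hb, pow_nonneg hr0.le 6, mul_nonneg (pow_nonneg (pow_nonneg hr0.le 12) 3)
      (pow_nonneg hr0.le 6)]
  have h2 : Real.sqrt (2 * (64 * (r ^ 12) ^ 3 + r ^ 12 + (C + 8) * ((r ^ 12) ^ 3 * r ^ 6))) / r ^ 6 ≤
      Real.sqrt (2 * (C + 73)) * r ^ 15 := by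
    rw [div_le_iff₀ (by positivity)]
    have h0 : 0 ≤ Real.sqrt (2 * (C + 73)) * r ^ 15 * r ^ 6 := by positivity
    calc Real.sqrt (2 * (64 * (r ^ 12) ^ 3 + r ^ 12 + (C + 8) * ((r ^ 12) ^ 3 * r ^ 6)))
        ≤ Real.sqrt ((Real.sqrt (2 * (C + 73)) * r ^ 15 * r ^ 6) ^ 2) := Real.sqrt_le_sqrt hR
      _ = Real.sqrt (2 * (C + 73)) * r ^ 15 * r ^ 6 := Real.sqrt_sq h0
  calc 2 * r ^ 12 + Real.sqrt (2 * (64 * (r ^ 12) ^ 3 + r ^ 12 + (C + 8) * ((r ^ 12) ^ 3 * r ^ 6))) /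
        r ^ 6 ≤ 2 * r ^ 15 + Real.sqrt (2 * (C + 73)) * r ^ 15 := add_le_add h1 h2
    _ = (2 + Real.sqrt (2 * (C + 73))) * r ^ 15 := by ring

open Classical in
/-- **The hypothesis of `kuniskyYu2022_theorem_1_2_of_T441` from FKM** (Kunisky–Yu, Theorem 3.35,
for all primes `p ≡ 1 (mod 4)`, with the Seidel entries of the Paley graph written as `0/±1` by
adjacency, as in the bridge). [cite: KuniskyYu2022, Theorem 3.35] -/
theorem paleyT441_hypothesis_of_kloosterman4 {C : ℝ} (hC : 0 ≤ C)
    (hFKM : ∀ (q : ℕ) [Fact q.Prime], ∀ a b c d : ZMod q, a ≠ 0 → b ≠ 0 → c ≠ 0 → d ≠ 0 →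
      ¬ ((a = b ∧ c = d) ∨ (a = c ∧ b = d) ∨ (a = d ∧ b = c)) →
      ‖∑ x ∈ (Finset.univ : Finset (ZMod q)).erase 0,
          kloostermanSum q 1 (a * x) * kloostermanSum q 1 (b * x) *
            kloostermanSum q 1 (c * x) * kloostermanSum q 1 (d * x)‖ ≤
        C * ((q : ℝ) ^ 2 * Real.sqrt q)) :
    ∃ C' : ℝ, ∀ q : ℕ, q.Prime → q % 4 = 1 →
      ∀ Vm : Matrix (Fin q) (Fin q) ℝ, Vmᵀ = Vm → (∀ x, Vm x x = 0) →
        |∑ a, ∑ b, ∑ c, ∑ d, Vm a b * Vm c d *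
          ((if a = c then 0 else if (paleyGraph q).Adj a c then (1 : ℝ) else -1) *
            (if a = d then 0 else if (paleyGraph q).Adj a d then (1 : ℝ) else -1) *
            (if b = c then 0 else if (paleyGraph q).Adj b c then (1 : ℝ) else -1) *
            (if b = d then 0 else if (paleyGraph q).Adj b d then (1 : ℝ) else -1))| ≤
          C' * (q : ℝ) ^ ((5 : ℝ) / 4) * ∑ a, ∑ b, Vm a b ^ 2 := by
  refine ⟨2 + Real.sqrt (2 * (C + 73)), fun q hq hq4 Vm _hVt hVd => ?_⟩
  obtain ⟨m, rfl⟩ : ∃ m, q = m + 1 := ⟨q - 1, (Nat.succ_pred_eq_of_pos hq.pos).symm⟩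
  haveI : Fact (m + 1).Prime := ⟨hq⟩
  have hq2 : m + 1 ≠ 2 := by omega
  -- Seidel entries are `χ(x - y)`
  set S : Matrix (Fin (m + 1)) (Fin (m + 1)) ℝ :=
    of fun x y => if x = y then 0 else if (paleyGraph (m + 1)).Adj x y then 1 else -1 with hSdef
  have hS : ∀ a b, S a b = if a = b then 0 else if (paleyGraph (m + 1)).Adj a b then 1 else -1 :=
    fun a b => rfl
  have hSχ : ∀ x y : ZMod (m + 1), S x y = ((quadraticChar (ZMod (m + 1)) (x - y) : ℤ) : ℝ) :=
    fun x y => paley_seidel_apply m hq4 hS x y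
  have hΘ : ∑ a, ∑ b, ∑ c, ∑ d, Vm a b * Vm c d *
      ((if a = c then 0 else if (paleyGraph (m + 1)).Adj a c then (1 : ℝ) else -1) *
        (if a = d then 0 else if (paleyGraph (m + 1)).Adj a d then (1 : ℝ) else -1) *
        (if b = c then 0 else if (paleyGraph (m + 1)).Adj b c then (1 : ℝ) else -1) *
        (if b = d then 0 else if (paleyGraph (m + 1)).Adj b d then (1 : ℝ) else -1)) =
      ∑ a : ZMod (m + 1), ∑ b : ZMod (m + 1), ∑ c : ZMod (m + 1), ∑ d : ZMod (m + 1),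
        Vm a b * Vm c d *
        (((quadraticChar (ZMod (m + 1)) (a - c) : ℤ) : ℝ) *
          ((quadraticChar (ZMod (m + 1)) (a - d) : ℤ) : ℝ) *
          ((quadraticChar (ZMod (m + 1)) (b - c) : ℤ) : ℝ) *
          ((quadraticChar (ZMod (m + 1)) (b - d) : ℤ) : ℝ)) := by
    refine Finset.sum_congr rfl fun a _ => Finset.sum_congr rfl fun b _ =>
      Finset.sum_congr rfl fun c _ => Finset.sum_congr rfl fun d _ => ?_
    rw [← hS a c, ← hS a d, ← hS b c, ← hS b d, hSχ a c, hSχ a d, hSχ b c, hSχ b d]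
  rw [hΘ]
  have hb := abs_paleyT441_form_le (p := m + 1) hq2 hC (hFKM (m + 1)) Vm hVd
  refine hb.trans (mul_le_mul_of_nonneg_right ?_ (Finset.sum_nonneg fun a _ =>
    Finset.sum_nonneg fun b _ => by positivity))
  have hP1 : (1 : ℝ) ≤ ((m + 1 : ℕ) : ℝ) := by exact_mod_cast hq.one_lt.le
  exact paleyT441_constant_le hP1 hC

/-- **Kunisky–Yu 2022, Theorem 1.2, from the Fouvry–Kowalski–Michel estimate.**  If for some
absolute constant `C`, for every prime `p` and all `a, b, c, d ∈ 𝔽_pˣ` in which some value occurs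
an odd number of times, `|∑_{x ∈ 𝔽_pˣ} K(ax) K(bx) K(cx) K(dx)| ≤ C p^{5/2}`
(`K(n) = S(1, n; p) = ∑_{y≠0} e((y + n ȳ)/p)`; this is [FKM15, Corollary 3.2] with `r = 2`,
`k = 4`, `h = 0`, i.e. Kunisky–Yu's Proposition 4.14, for the unnormalised Kloosterman sums), then
the degree-4 SOS relaxation of the clique number of the Paley graph satisfies
`SOS₄(G_p) = las⁽²⁾(Ḡ_p) ≥ c p^{1/3}` for all primes `p ≡ 1 (mod 4)`.  Everything else in
Kunisky–Yu's proof (§3–§4, including Theorem 4.22, whose input [Liu02] is given an elementary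
proof in `Literature.NumberTheory.GaussSums.KloostermanTwistedMoment`) is PROVED in the tree.
[cite: KuniskyYu2022, Theorem 1.2] -/
theorem kuniskyYu2022_theorem_1_2_of_kloosterman4
    (hFKM : ∃ C : ℝ, ∀ (q : ℕ) [Fact q.Prime], ∀ a b c d : ZMod q,
      a ≠ 0 → b ≠ 0 → c ≠ 0 → d ≠ 0 →
      ¬ ((a = b ∧ c = d) ∨ (a = c ∧ b = d) ∨ (a = d ∧ b = c)) →
      ‖∑ x ∈ (Finset.univ : Finset (ZMod q)).erase 0,
          kloostermanSum q 1 (a * x) * kloostermanSum q 1 (b * x) *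
            kloostermanSum q 1 (c * x) * kloostermanSum q 1 (d * x)‖ ≤
        C * (q : ℝ) ^ ((5 : ℝ) / 2)) :
    kuniskyYu2022_theorem_1_2 := by
  obtain ⟨C, hC⟩ := hFKM
  refine kuniskyYu2022_theorem_1_2_of_T441
    (paleyT441_hypothesis_of_kloosterman4 (C := max C 0) (le_max_right C 0) ?_)
  intro q _ a b c d ha hb hc hd hnp
  have h := hC q a b c d ha hb hc hd hnp
  have h52 : (q : ℝ) ^ ((5 : ℝ) / 2) = (q : ℝ) ^ 2 * Real.sqrt q := by
    have hq : (0 : ℝ) ≤ q := Nat.cast_nonneg q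
    rw [Real.sqrt_eq_rpow, ← Real.rpow_natCast, ← Real.rpow_add' hq (by norm_num)]
    norm_num
  rw [h52] at h
  refine h.trans (mul_le_mul_of_nonneg_right (le_max_left C 0) (by positivity))

end Bound

end Literature.Combinatorics.SimpleGraph

end
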